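import Summits.ResolutionOfSingularities.ResolutionOfSingularities.Theorems.FrobeniusLadderFInjectiveMacaulayficationFCentreE1TierOne
import HarnessLib

/-!
# R17.11 TIER-1, PART 3 — EXPONENT-FREE LEMMA-N BINDER `∃ n ≥ 1, ∃ c ≠ 0, [[F_*A]] ∼ c · 𝔮̄ⁿ`
# (crux `FInjectiveMacaulayfication` stmt-ResolutionOfSingularities-15315, chain w45a; res-L1-w45a-plan-1 RULING R17.14 (2); text = res-L1-w45a-tri-2 g14's CHECKED
# REPAIR `L/res-L1-w45a-tri-2/g14/TierOneNormPow.lean` 2795f782166325fe (first-step audit `g14/LEMMA-N-EXPONENT.md`), filed by seat res-L1-w45a-stub-2 g7)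

[OURS · L1 W4.5a] Support file (`--supports stmt-ResolutionOfSingularities-15315 --as helper`); def-free; negative-modulo-H about the CANDIDATE census
statement `FCentreCandidate.LFBAdm`; replaces the role of NO printed item; NOT a statement of the manuscript; AI-written (AI review is weaker than expert review).
Mathematics of the repair: res-L1-w45a-tri-2 g14 (exponent audit) and res-L1-w45a-lead-1 g8 (norm class `𝔮̄⁸`); proof body = `FCentreE1TierOne` §4 read along `𝔮̄ⁿ`.

WHY. The landed `FCentreE1TierOne.not_lFBAdm_two_one_four` carries LEMMA N with the FIXED exponent `𝔮̄ ^ 4`. The engine behind LEMMA N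
(res-L1-w45a-idea-1 FB5-r1 §1, `fb5.py`: `q = 16`, TWO identical `8 × 8` blocks, one-block stripped norm `N₀ = x²⁴ · 𝔮̄⁴`, colength 100) gives the
Frobenius norm ideal CLASS of `A = 𝒪_{X,v}` as `[[F_* A]] = [[M₀]]² ∼ 𝔮̄ ^ 8` (`F_* A = M₀ ⊕ x^{1/2} M₀` along the `x`-parity grading; maximal minors
of a block-diagonal coordinate matrix are products of block minors, so the norm is multiplicative), and `c · 𝔮̄⁴` is NOT in the class of `𝔮̄⁸` in a
normal local domain of dimension ≥ 2 (else `𝔮̄⁴ = unit · 𝔮̄⁸`, Nakayama). So the exponent-4 binder is unsatisfiable for every `k`, and the right binder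
is exponent 8 (perfect `k`) — or, robustly, SOME exponent `n ≥ 1` (F-finite `k`: `n = 8 · [k : k²]`). Blow-ups do not see the exponent
(`CoreRungClosure.isBlowup_idealSheaf_pow`), so part 3's proof goes through VERBATIM with the model taken along `𝔮̄ ^ n`.

★ `not_lFBAdm_two_one_four_of_normPow (hN♭ : ∀ K, ∃ n > 0, ∃ c ≠ 0, IsFrobeniusNormIdeal K 2 1 (c · 𝔮̄ⁿ A)) : ¬ FCentreCandidate.LFBAdm 2 1 4`.
[folklore assembly, OURS as a certificate; cite: Villamayoru2006, Thm. 3.3 and 3.4; Yasuda2012, Def. 2.2 and Cor. 2.6; StacksProject, Tag 080A]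
-/

-- single-problem summit: the doubled namespace component is forced
set_option linter.dupNamespace false

noncomputable section

open AlgebraicGeometry CategoryTheory CategoryTheory.Limits Literature.AlgebraicGeometry.Resolution TopologicalSpace IsLocalRing MvPolynomial

namespace Summit.ResolutionOfSingularities.ResolutionOfSingularities.Theorems.FInjectiveMacaulayfication.FCentreE1TierOneNormPow

open Summit.ResolutionOfSingularities.ResolutionOfSingularities.Theorems.FInjectiveMacaulayfication
open SliceableCentre GermForm FCentreE1ChartWitness FCentreE1ChartPresentation FCentreE1RungZero FCentreE1TierOne

/-- ★ **R17.11 TIER 1 with the exponent-free LEMMA-N binder**: for `f = z² + x⁴z + y³ + u³ + t³` over a field `k` of characteristic 2 and `v` the origin,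
IF for every fraction field `K` of `A = 𝒪_{X,v}` some `c · 𝔮̄ⁿ A` (`n ≥ 1`, `c ≠ 0`, `𝔮̄ = (x̄², ȳ, ū, t̄, z̄)`) is a first Frobenius norm ideal of `A`, THEN
`¬ LFBAdm 2 1 4`. Proof = `FCentreE1TierOne.not_lFBAdm_two_one_four` verbatim with the model `affineBlowup I_A` read as a blowing up along `𝔮̄ⁿ`
(`isBlowup_idealSheaf_pow`). The engine value is `n = 8`, `c = 1` for perfect `k` (FB5-r1: two identical blocks, `N₀ = x²⁴ 𝔮̄⁴`). [OURS · certificate] -/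
theorem not_lFBAdm_two_one_four_of_normPow (k : Type) [Field k] [CharP k 2] (f : MvPolynomial (Fin 5) k)
    (hf : f = X 4 ^ 2 + X 0 ^ 4 * X 4 + X 1 ^ 3 + X 2 ^ 3 + X 3 ^ 3)
    (v : Spec (.of (MvPolynomial (Fin 5) k ⧸ Ideal.span {f})))
    (hv : v.asIdeal = Ideal.span (Set.range fun j : Fin 5 => Ideal.Quotient.mk (Ideal.span {f}) (X j)))
    (hN : ∀ (K : Type) [Field K] [Algebra ((Spec (.of (MvPolynomial (Fin 5) k ⧸ Ideal.span {f}))).presheaf.stalk v) K]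
        [IsFractionRing ((Spec (.of (MvPolynomial (Fin 5) k ⧸ Ideal.span {f}))).presheaf.stalk v) K] [ExpChar K 2],
        ∃ (n : ℕ) (c : (Spec (.of (MvPolynomial (Fin 5) k ⧸ Ideal.span {f}))).presheaf.stalk v), 0 < n ∧ c ≠ 0 ∧
          IsFrobeniusNormIdeal K 2 1 (Ideal.span {c} *
            (Ideal.span {Ideal.Quotient.mk (Ideal.span {f}) (X 0) ^ 2, Ideal.Quotient.mk (Ideal.span {f}) (X 1),
                Ideal.Quotient.mk (Ideal.span {f}) (X 2), Ideal.Quotient.mk (Ideal.span {f}) (X 3), Ideal.Quotient.mk (Ideal.span {f}) (X 4)} ^ n).map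
              ((((Spec (.of (MvPolynomial (Fin 5) k ⧸ Ideal.span {f}))).presheaf.germ ⊤ v trivial).hom.comp
                (Scheme.ΓSpecIso (.of (MvPolynomial (Fin 5) k ⧸ Ideal.span {f}))).inv.hom)))) :
    ¬ FCentreCandidate.LFBAdm 2 1 4 := by
  classical
  intro hL
  haveI hfp : (Ideal.span {f}).IsPrime := (Ideal.span_singleton_prime (prime_f k f hf).ne_zero).mpr (prime_f k f hf)
  haveI : IsDomain (MvPolynomial (Fin 5) k ⧸ Ideal.span {f}) := Ideal.Quotient.isDomain _
  haveI hXint : IsIntegral (Spec (.of (MvPolynomial (Fin 5) k ⧸ Ideal.span {f}))) := isIntegral_p2d4c k f hf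
  -- the rung-0 instantiation: `𝓚` with (c4) and (c5)
  obtain ⟨𝓚, -, -, -, hc4, hc5⟩ := lFBAdm_at_p2d4c hL k f hf v hv
  -- instances on `S′ = Spec 𝒪_{X,v}`
  haveI hSint : IsIntegral (Spec ((Spec (.of (MvPolynomial (Fin 5) k ⧸ Ideal.span {f}))).presheaf.stalk v)) :=
    FCentreCandidate.isIntegral_of_isBlowup_stalk (X := Spec (.of (MvPolynomial (Fin 5) k ⧸ Ideal.span {f}))) v
      (top_ne_bot_idealSheafData_Spec_stalk v) (isBlowup_id_top _)
  haveI hSexp : ExpChar (Spec ((Spec (.of (MvPolynomial (Fin 5) k ⧸ Ideal.span {f}))).presheaf.stalk v)).functionField 2 :=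
    FCentreCandidate.expChar_functionField_of_isBlowup_stalk 2 Nat.prime_two (X := Spec (.of (MvPolynomial (Fin 5) k ⧸ Ideal.span {f})))
      (Spec.map (CommRingCat.ofHom (algebraMap k (MvPolynomial (Fin 5) k ⧸ Ideal.span {f})))) v
      (top_ne_bot_idealSheafData_Spec_stalk v) (isBlowup_id_top _)
  -- blow up along `𝓚`: an F-blowup (c4), FULL everywhere (c5)
  obtain ⟨S'', π, hπ⟩ := exists_isBlowup _ 𝓚
  have hF : IsFBlowup 2 1 π := hc4 S'' π hπ
  -- LEMMA N in the function field of `S′`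
  obtain ⟨n, c, hn, hc0, hcN⟩ := hN (Spec ((Spec (.of (MvPolynomial (Fin 5) k ⧸ Ideal.span {f}))).presheaf.stalk v)).functionField
  -- the model `affineBlowup I_A → Spec R̄` is a blowing up along `𝔮̄⁴`
  have hmodel := Summit.ResolutionOfSingularities.ResolutionOfSingularities.Theorems.CoreRungClosure.isBlowup_idealSheaf_pow
    (affineBlowup_IA_isBlowup_q k f hf) n hn
  have h𝔮 : Ideal.span {Ideal.Quotient.mk (Ideal.span {f}) (X 0) ^ 2, Ideal.Quotient.mk (Ideal.span {f}) (X 1),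
      Ideal.Quotient.mk (Ideal.span {f}) (X 2), Ideal.Quotient.mk (Ideal.span {f}) (X 3), Ideal.Quotient.mk (Ideal.span {f}) (X 4)} ^ n ≠ ⊥ := by
    intro hbot
    have hmem : Ideal.Quotient.mk (Ideal.span {f}) (X 1) ^ n ∈ Ideal.span {Ideal.Quotient.mk (Ideal.span {f}) (X 0) ^ 2,
        Ideal.Quotient.mk (Ideal.span {f}) (X 1), Ideal.Quotient.mk (Ideal.span {f}) (X 2), Ideal.Quotient.mk (Ideal.span {f}) (X 3),
        Ideal.Quotient.mk (Ideal.span {f}) (X 4)} ^ n :=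
      Ideal.pow_mem_pow (Ideal.subset_span (by simp)) n
    rw [hbot, Ideal.mem_bot] at hmem
    exact pow_ne_zero n (mk_X_ne_zero k f hf).2 hmem
  -- §3: the base-changed model embeds openly into `S″`
  obtain ⟨g, hg⟩ := exists_openImmersion_pullback_model_of_isFBlowup v _ h𝔮 hmodel hF c hc0 hcN
  -- §2: the bad point of the model, lifted to the base change (pro-open: isomorphic stalks)
  obtain ⟨y, hyv, hybad⟩ := exists_chartOrigin_over_vertex k f (X 4 ^ 2 + X 0 ^ 2 * X 4 + X 0 ^ 2 * (X 1 ^ 3 + X 2 ^ 3 + X 3 ^ 3)) hf rfl v hv _ rfl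
  obtain ⟨t, ht⟩ := mem_range_pullback_fst_fromSpecStalk_of_eq (affineBlowup.π _) v hyv
  haveI : Flat ((Spec (.of (MvPolynomial (Fin 5) k ⧸ Ideal.span {f}))).fromSpecStalk v) := flat_fromSpecStalk _ v
  haveI := isIso_stalkMap_of_flat_of_isPreimmersion
    (pullback.fst (affineBlowup.π _) ((Spec (.of (MvPolynomial (Fin 5) k ⧸ Ideal.span {f}))).fromSpecStalk v)) t
  -- (c5) at the image of `t` in `S″`, transported back along the open immersion and down to the model
  have hfull_t := FTemkinClosedPoints.fullCl_of_isIso_stalkMap' 2 g t (hc5 S'' π hπ (g t))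
  have hfull_y := FTemkinClosedPoints.fullCl_of_isIso_stalkMap 2
    (pullback.fst (affineBlowup.π _) ((Spec (.of (MvPolynomial (Fin 5) k ⧸ Ideal.span {f}))).fromSpecStalk v)) t hfull_t
  rw [ht] at hfull_y
  exact hybad hfull_y

end Summit.ResolutionOfSingularities.ResolutionOfSingularities.Theorems.FInjectiveMacaulayfication.FCentreE1TierOneNormPow

end
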